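import Mathlib
import Summits.Ventures.HodgeRepro2.T5DualPairSwap
import Summits.Ventures.HodgeRepro2.T5TrivialPartner
import Summits.Ventures.HodgeRepro2.T5Persistence
import Summits.Ventures.HodgeRepro2.T6N42Tower
import Summits.Ventures.HodgeRepro2.T6N42Defs
import Summits.Ventures.HodgeRepro2.T6N42Datum
import Summits.Ventures.HodgeRepro2.T6N42Hyp
import Summits.Ventures.HodgeRepro2.T6N42HypGQT

/-!
# T6N42Main — sub-step N4.2 «finite places: the local theta lift of π₀,v is non-zero»: the print
path in kernel

TIER5 §N4.2 (route/T5-route-3.md v0.36 §B + §K.2) at every finite place `v` of `F⁺`: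
* `v` split in `E` (row B2): the dual pair is `(GL₂(F_v), GL₃(F_v))` = Mínguez's `(G_n, G_m)` with
  `n = 2 ≤ m = 3`, and Thm. 1(2) gives `Hom_{G_n}(ω_{n,m}, π₀,v) ≠ 0` for every irreducible smooth
  `π₀,v` — `N42_split`;
* `v` non-split (§K.2): `π₀,v = θ_{W₁₂,v}(β′_v)` means `Hom_{U(V′_v) × U(W₁₂,v)}(ω, β′_v ⊠ π₀,v) ≠ 0`;
  composing a non-zero such map with `π₀,v ⊗ ℂ ≃ π₀,v` gives `Hom_{U(W₁₂,v)}(ω_{V₀}, π₀,v) ≠ 0`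
  (`thetaNonzero_of_hasPartner` — §K.2's one-line [A], now a kernel lemma), so the first occurrence
  index of `π₀,v` for the Witt tower on `V₀ = V′_v` is `r₀ = 0` (`isFirstOccurrenceIndex_zero`), and
  Gan–Ichino Prop. 5.3(i) gives `Θ_{V_r}(π₀,v) ≠ 0` for every `r`, in particular for `r = 1`,
  `V₁ = V′_v ⊕ ℍ ≅ V_v` — `N42_nonsplit`.
`N42_main` assembles both over the datum of record `N42Datum.FinitePlacesDatum` (TARGET-T6 v0.4
§9.6 (1)); its hypotheses are the two displays of `T6N42Hyp.lean` at every place plus the three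
INTERFACE Props of the datum (`π₀,v` irreducible smooth; `n ≤ m` at the split places, with
`0 < n` as the plain binder `hpos`; the first-lift relation at the non-split places — TIER5 §B's
standing data «π₀,v = θ_{W₁₂,v}(β′_v)»),
each to be discharged in kernel or declared at the M2 declaration (ruling l. 4414 (q4); §9.5).
`N42_zeta_main` adds row B0: with GQT Prop. 35(i) (`T6N42HypGQT.lean`, residual class AC) at every
place, the zeta-integral form `ZetaNonzeroEverywhere` — the (H_loc) shape of §9.3. The last section
ties the datum to seat p3's `T5Persistence.TowerOccurrence` model and to `T6N42Tower.Persists` (the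
corroboration lane, rows B3–B4): GI's first occurrence index is p3's `first`, and the GI display
yields persistence of the induced occurrence model.

README §8(d): uses an L-value-free non-vanishing device: NO (TIER5 §N4.2, a pre-02:16Z line of
record, continued).
-/

namespace Summit.Ventures.HodgeRepro2.T6.N42Datum.FinitePlacesDatum

/-- The places of the datum as one type: the split ones on the left, the non-split ones on the
right (for the composition's compat fields, which quantify over one type of places). -/
abbrev Place (D : FinitePlacesDatum) : Type :=
  D.SplitPlace ⊕ D.NonsplitPlace

/-- «Θ(π₀,v) ≠ 0» at one place of the datum. -/
def ThetaNonzeroAt (D : FinitePlacesDatum) : D.Place → Prop :=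
  Sum.elim (fun v => (D.splitDatum v).HomNonzero) (fun v => (D.towerDatum v).Occurs 1)

/-- «Z_v^*(½) ≢ 0» at one place of the datum. -/
def ZetaNonzeroAt (D : FinitePlacesDatum) : D.Place → Prop :=
  Sum.elim (fun v => (D.zetaSplit v).Nonzero) (fun v => (D.zetaNonsplit v).Nonzero)

/-- `ThetaNonzeroEverywhere` is the per-place statement over `D.Place`. -/
theorem thetaNonzeroEverywhere_iff (D : FinitePlacesDatum) :
    D.ThetaNonzeroEverywhere ↔ ∀ p, D.ThetaNonzeroAt p := by
  constructor
  · rintro ⟨hs, hn⟩ (v | v)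
    · exact hs v
    · exact hn v
  · intro h
    exact ⟨fun v => h (Sum.inl v), fun v => h (Sum.inr v)⟩

/-- `ZetaNonzeroEverywhere` is the per-place statement over `D.Place`. -/
theorem zetaNonzeroEverywhere_iff (D : FinitePlacesDatum) :
    D.ZetaNonzeroEverywhere ↔ ∀ p, D.ZetaNonzeroAt p := by
  constructor
  · rintro ⟨hs, hn⟩ (v | v)
    · exact hs v
    · exact hn v
  · intro h
    exact ⟨fun v => h (Sum.inl v), fun v => h (Sum.inr v)⟩

end Summit.Ventures.HodgeRepro2.T6.N42Datum.FinitePlacesDatum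

namespace Summit.Ventures.HodgeRepro2.T6.N42Main

open Summit.Ventures.HodgeRepro2
open Summit.Ventures.HodgeRepro2.T6.N42Defs
open Summit.Ventures.HodgeRepro2.T6.N42Datum
open Summit.Ventures.HodgeRepro2.T5DualPairSwap
open Summit.Ventures.HodgeRepro2.T5TrivialPartner

/-- The isomorphism `Vπ ⊗ ℂ ≃ Vπ` is `G(W)`-equivariant for `π ⊠ 1` and `π`. -/
theorem rid_map_eq (S : DualPairDatum) (g : S.G) (x : TensorProduct ℂ S.Vπ ℂ) :
    (TensorProduct.rid ℂ S.Vπ) (TensorProduct.map (S.π g) LinearMap.id x) =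
      S.π g ((TensorProduct.rid ℂ S.Vπ) x) := by
  induction x using TensorProduct.induction_on with
  | zero => simp
  | tmul a c => simp [TensorProduct.rid_tmul]
  | add x y hx hy => simp [map_add, hx, hy]

/-- TIER5 §K.2, the one-line [A] («a non-zero such map factors through the maximal π₀,v-isotypic
quotient π₀,v ⊠ Θ(π₀,v), whence Θ_{V₀,W,χ,ψ}(π₀,v) ≠ 0»): if `ω` has the partner `(π, β)` with `β` a
character of `H(V)` — `Hom_{G(W)×H(V)}(ω, π ⊠ β) ≠ 0`, seat p3's `HasPartner` — then
`Hom_{G(W)}(ω, π) ≠ 0`, i.e. `Θ_{V,W,χ,ψ}(π) ≠ 0` in the sense of `DualPairDatum.ThetaNonzero`. -/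
theorem thetaNonzero_of_hasPartner (S : DualPairDatum) (β : S.H →* ℂˣ)
    (h : HasPartner S.ω S.π (charLinRep β)) : S.ThetaNonzero := by
  obtain ⟨f, hf0, hf⟩ := h
  refine ⟨(TensorProduct.rid ℂ S.Vπ).toLinearMap ∘ₗ f, ?_, ?_⟩
  · intro h0
    apply hf0
    ext x
    have hx := LinearMap.congr_fun h0 x
    simp only [LinearMap.comp_apply, LinearEquiv.coe_coe, LinearMap.zero_apply] at hx
    exact (TensorProduct.rid ℂ S.Vπ).map_eq_zero_iff.mp hx
  · refine ⟨fun g v => ?_⟩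
    have hgv := hf.isIntertwining (g, 1) v
    simp only [LinearMap.comp_apply, LinearEquiv.coe_coe, DualPairDatum.ωG_apply, hgv,
      T5SplittingTwist.extTprod_apply, map_one, Module.End.one_eq_id]
    exact rid_map_eq S g (f v)

/-- GI online-first p. 22 ll. 13–14: if `π` occurs at the bottom `V₀` of the tower, its first
occurrence index is `0`. -/
theorem isFirstOccurrenceIndex_zero (T : TowerDatum) (h : T.Occurs 0) :
    T.IsFirstOccurrenceIndex 0 :=
  ⟨h, fun r hr => absurd hr (Nat.not_lt_zero r)⟩

/-- TIER5 §K.2 in kernel: `π` occurs with the character `β` at the bottom of the Witt tower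
(`Hom_{G(W)×H(V₀)}(ω_{V₀}, π ⊠ β) ≠ 0`), so its first occurrence index is `0`, and Gan–Ichino
Prop. 5.3(i) (the display, for irreducible smooth `π`) gives `Θ_{V_r,W,χ,ψ}(π) ≠ 0` for every
`r`. -/
theorem occurs_of_hasPartner_zero (T : TowerDatum) (hirr : T.Irreducible) (hsm : T.Smooth)
    (hGI : Hyp.GanIchino2014_Prop5_3_i T) (β : T.H 0 →* ℂˣ)
    (h0 : HasPartner (T.ω 0) T.π (charLinRep β)) (r : ℕ) : T.Occurs r :=
  hGI hirr hsm 0 (isFirstOccurrenceIndex_zero T (thetaNonzero_of_hasPartner (T.pair 0) β h0)) r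
    (Nat.zero_le r)

/-- N4.2 at a finite place NON-SPLIT in `E` (TIER5 §K.2): `Θ_{V₁,W,χ,ψ}(π₀,v) ≠ 0`, `V₁ = V′_v ⊕ ℍ`
(`≅ V_v` by the classification of hermitian spaces, row B4's printed input — the identification
`V₁ = V_v` is the instantiation's, not this file's). -/
theorem N42_nonsplit (T : TowerDatum) (hirr : T.Irreducible) (hsm : T.Smooth)
    (hGI : Hyp.GanIchino2014_Prop5_3_i T) (β : T.H 0 →* ℂˣ)
    (h0 : HasPartner (T.ω 0) T.π (charLinRep β)) : T.Occurs 1 :=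
  occurs_of_hasPartner_zero T hirr hsm hGI β h0 1

/-- N4.2 at a finite place SPLIT in `E` (TIER5 §B row B2): Mínguez Thm. 1(2) for `n ≤ m` gives
`Hom_{G_n}(ω_{n,m}, π₀,v) ≠ 0` for every irreducible smooth `π₀,v`. -/
theorem N42_split (S : TypeIIDatum) (hirr : S.Irreducible) (hsm : S.Smooth) (hpos : 0 < S.n)
    (hnm : S.n ≤ S.m) (hM : Hyp.Minguez2008_Theoreme1_2 S) : S.HomNonzero :=
  hM hirr hsm hpos hnm

/-- N4.2, the print path, in kernel: modulo the displays of Mínguez 2008 Thm. 1(2) at every split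
place and Gan–Ichino 2014 Prop. 5.3(i) at every non-split place, and the three interface Props of
the datum, the local theta lift of `π₀,v` is non-zero at every finite place of `F⁺`. -/
theorem N42_main (D : FinitePlacesDatum) (hIS : D.IrreducibleSmooth)
    (hpos : ∀ v, 0 < (D.splitDatum v).n) (hnm : D.TypeIISizes) (hFL : D.FirstLift)
    (hM : ∀ v, Hyp.Minguez2008_Theoreme1_2 (D.splitDatum v))
    (hGI : ∀ v, Hyp.GanIchino2014_Prop5_3_i (D.towerDatum v)) : D.ThetaNonzeroEverywhere :=
  ⟨fun v => N42_split (D.splitDatum v) (hIS.1 v).1 (hIS.1 v).2 (hpos v) (hnm v) (hM v),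
    fun v => N42_nonsplit (D.towerDatum v) (hIS.2 v).1 (hIS.2 v).2 (hGI v) (D.β' v) (hFL v)⟩

/-- Row B0 at a non-split place: with GQT Prop. 35(i) (display of class AC) the theta-side
conclusion of `N42_nonsplit` becomes `Z_v^*(½) ≢ 0`. -/
theorem N42_zeta_nonsplit (T : TowerDatum) (Z : ZetaDatum (T.pair 1))
    (hGQT : Hyp.GQT2014_Prop35_i (T.pair 1) Z) (h : T.Occurs 1) : Z.Nonzero :=
  hGQT.mp h

/-- Row B0 at a split place. -/
theorem N42_zeta_split (S : TypeIIDatum) (Z : ZetaDatum S.pair)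
    (hGQT : Hyp.GQT2014_Prop35_i S.pair Z) (h : S.HomNonzero) : Z.Nonzero :=
  hGQT.mp h

/-- N4.2 in the zeta-integral form of (R2) (TIER5 §B row B0; TARGET-T6 v0.4 §9.3's (H_loc) shape):
modulo the two print-path displays, the three interface Props and GQT Prop. 35(i) (class AC) at
every finite place, `Z_v^*(½) ≢ 0` on `R(V_v) ⊗ π₀,v^∨ ⊗ π₀,v` at every finite place of `F⁺`. -/
theorem N42_zeta_main (D : FinitePlacesDatum) (hIS : D.IrreducibleSmooth)
    (hpos : ∀ v, 0 < (D.splitDatum v).n) (hnm : D.TypeIISizes) (hFL : D.FirstLift)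
    (hM : ∀ v, Hyp.Minguez2008_Theoreme1_2 (D.splitDatum v))
    (hGI : ∀ v, Hyp.GanIchino2014_Prop5_3_i (D.towerDatum v))
    (hGQTs : ∀ v, Hyp.GQT2014_Prop35_i (D.splitDatum v).pair (D.zetaSplit v))
    (hGQTn : ∀ v, Hyp.GQT2014_Prop35_i ((D.towerDatum v).pair 1) (D.zetaNonsplit v)) :
    D.ZetaNonzeroEverywhere :=
  ⟨fun v => N42_zeta_split _ _ (hGQTs v) ((N42_main D hIS hpos hnm hFL hM hGI).1 v),
    fun v => N42_zeta_nonsplit _ _ (hGQTn v) ((N42_main D hIS hpos hnm hFL hM hGI).2 v)⟩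

/-- Seat p3's occurrence model attached to a tower datum in which `π` occurs at the level `n`
(GI (5.1) supplies such a level in print — «such an r₀ exists and r₀ ≤ dim W»; here it is a
hypothesis, since (5.1) is not displayed). -/
def toOccurrence (T : TowerDatum) (h : T.Occurs T.n) : T5Persistence.TowerOccurrence :=
  ⟨T.n, T.Occurs, h⟩

/-- The induced model occurs exactly where the datum does. -/
theorem toOccurrence_occurs (T : TowerDatum) (h : T.Occurs T.n) (r : ℕ) :
    (toOccurrence T h).occurs r ↔ T.Occurs r := Iff.rfl

/-- GI's first occurrence index is p3's `first` (the `Nat.find` of the model). -/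
theorem first_toOccurrence (T : TowerDatum) (h : T.Occurs T.n) {r₀ : ℕ}
    (hr₀ : T.IsFirstOccurrenceIndex r₀) : (toOccurrence T h).first = r₀ := by
  have hle : (toOccurrence T h).first ≤ r₀ :=
    T5Persistence.TowerOccurrence.first_le_of_occurs (toOccurrence T h) hr₀.1
  have hge : ¬ (toOccurrence T h).first < r₀ := fun hlt =>
    hr₀.2 _ hlt (T5Persistence.TowerOccurrence.occurs_first (toOccurrence T h))
  omega

/-- p3's `first` is a first occurrence index in GI's sense. -/
theorem isFirstOccurrenceIndex_first (T : TowerDatum) (h : T.Occurs T.n) :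
    T.IsFirstOccurrenceIndex (toOccurrence T h).first :=
  ⟨T5Persistence.TowerOccurrence.occurs_first (toOccurrence T h), fun _ hr =>
    T5Persistence.TowerOccurrence.not_occurs_of_lt_first (toOccurrence T h) hr⟩

/-- Under the Gan–Ichino display (for irreducible smooth `π`), the induced occurrence model
PERSISTS in the sense of `T6N42Tower.Persists` (= HKS96 Prop. 5.1(iii)'s shape, the corroboration
lane of TIER5 §B rows B3–B4): from its first occurrence on, `π` occurs at every level. -/
theorem persists_of_ganIchino (T : TowerDatum) (hirr : T.Irreducible) (hsm : T.Smooth)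
    (hGI : Hyp.GanIchino2014_Prop5_3_i T) (h : T.Occurs T.n) :
    N42Tower.Persists (toOccurrence T h) :=
  fun m' hm' => hGI hirr hsm _ (isFirstOccurrenceIndex_first T h) m' hm'

end Summit.Ventures.HodgeRepro2.T6.N42Main
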